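import Mathlib.Analysis.Fourier.ZMod
import Mathlib.Analysis.Complex.Trigonometric
import HarnessLib

/-!
# An infrared-type bound for convex-off-the-origin functions on the cycle `ℤ/Lℤ`

Topic `Literature/Probability/LatticeModels`. A purely finite, elementary lemma isolated from the
transfer-matrix / reflection-positivity proofs of infrared bounds (Fröhlich–Simon–Spencer 1976,
Appendix; Borgs–Seiler 1983, Lemma III.8, (III.32)): if a real function `g` on the cycle `ℤ/Lℤ`
has nonnegative second differences away from the origin,
`Δ²g(n) = g(n+1) − 2g(n) + g(n−1) ≥ 0` for `n ≠ 0`, then for every lattice momentum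
`p = 2πm/L` its (real part of the) discrete Fourier transform obeys

`(1 − cos p) · Re Σ_n e^{−ipn} g(n) ≤ 2g(0) − g(1) − g(−1) = −Δ²g(0)`.

Proof: summation by parts on the cycle gives `2(1 − cos p) Σ_n e^{−ipn} g(n) = −Σ_n e^{−ipn} Δ²g(n)`;
the terms `n ≠ 0` are bounded by `|cos| ≤ 1` and `Δ²g(n) ≥ 0`, and `Σ_n Δ²g(n) = 0`. In the
applications `g(n)` is a two-point function along one lattice direction (transversally smeared),
whose convexity off the origin is reflection positivity through lattice planes and through planes
half-way between them; the right-hand side is the "double commutator" `⟨|A₀ − A₁|²⟩`.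

* `cycleLaplacian g n` — the second difference `Δ²g(n)` on `ℤ/Lℤ`;
* `sum_cycleLaplacian` — `Σ_n Δ²g(n) = 0`;
* `stdAddChar_symm_sub_two_mul_sum` — summation by parts
  `(ψ(m) + ψ(−m) − 2) Σ_n ψ(−mn) g(n) = Σ_n ψ(−mn) Δ²g(n)`, `ψ = ZMod.stdAddChar`;
* `one_sub_re_stdAddChar_mul_re_sum_le` — the bound above, with `1 − cos p = 1 − Re ψ(m)`;
* `re_stdAddChar_eq_cos` — `Re ψ(m) = cos(2π m/L)`, and the cosine form
  `one_sub_cos_mul_re_sum_le`.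

Everything here is proved; no named fact. [folklore]

## References

* J. Fröhlich, B. Simon, T. Spencer, Comm. Math. Phys. 50 (1976) 79–95, Appendix (transfer-matrix
  proof of the infrared bound).
* C. Borgs, E. Seiler, Comm. Math. Phys. 91 (1983) 329–380, §III.2, Lemma III.8 (III.32)–(III.33),
  p. 349. [BorgsSeiler1983]
-/

noncomputable section

open Finset Complex
open scoped ComplexConjugate

namespace Literature.Probability.LatticeModels

variable {L : ℕ} [NeZero L]

/-- The second difference ("lattice Laplacian") of a real function on the cycle `ℤ/Lℤ`:
`Δ²g(n) = g(n+1) − 2g(n) + g(n−1)`. [folklore] -/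
def cycleLaplacian (g : ZMod L → ℝ) (n : ZMod L) : ℝ :=
  g (n + 1) - 2 * g n + g (n - 1)

omit [NeZero L] in
/-- Unfolding `cycleLaplacian`. [folklore] -/
theorem cycleLaplacian_apply (g : ZMod L → ℝ) (n : ZMod L) :
    cycleLaplacian g n = g (n + 1) - 2 * g n + g (n - 1) := rfl

omit [NeZero L] in
/-- At the origin: `−Δ²g(0) = 2g(0) − g(1) − g(−1)`. [folklore] -/
theorem neg_cycleLaplacian_zero (g : ZMod L → ℝ) :
    -cycleLaplacian g 0 = 2 * g 0 - g 1 - g (-1) := by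
  simp only [cycleLaplacian, zero_add, zero_sub]; ring

/-- The second differences on the cycle sum to zero (telescoping). [folklore] -/
theorem sum_cycleLaplacian (g : ZMod L → ℝ) : ∑ n, cycleLaplacian g n = 0 := by
  simp only [cycleLaplacian, sum_add_distrib, sum_sub_distrib, ← mul_sum]
  have h1 : ∑ x : ZMod L, g (x + 1) = ∑ x, g x := Equiv.sum_comp (Equiv.addRight (1 : ZMod L)) g
  have h2 : ∑ x : ZMod L, g (x - 1) = ∑ x, g x := Equiv.sum_comp (Equiv.subRight (1 : ZMod L)) g
  rw [h1, h2]
  ring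

/-- `Re ψ(m) = cos(2π m/L)` for the standard additive character `ψ` of `ℤ/Lℤ` (`m` represented by
`m.val ∈ [0, L)`). [folklore] -/
theorem re_stdAddChar_eq_cos (m : ZMod L) :
    (ZMod.stdAddChar m : ℂ).re = Real.cos (2 * Real.pi * m.val / L) := by
  rw [ZMod.stdAddChar_apply, ZMod.toCircle_apply]
  have : (2 * (Real.pi : ℂ) * I * (m.val : ℂ) / (L : ℂ)) = ((2 * Real.pi * m.val / L : ℝ) : ℂ) * I := by
    push_cast; ring
  rw [this, Complex.exp_ofReal_mul_I_re]

/-- `ψ(−m) = conj ψ(m)` (the character takes values on the unit circle). [folklore] -/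
theorem stdAddChar_neg_eq_conj (m : ZMod L) :
    (ZMod.stdAddChar (-m) : ℂ) = conj (ZMod.stdAddChar m : ℂ) := by
  rw [AddChar.map_neg_eq_inv, Complex.inv_def, Complex.normSq_eq_norm_sq, ZMod.stdAddChar_apply,
    Circle.norm_coe]
  simp

/-- `|Re ψ(m)| ≤ 1`. [folklore] -/
theorem abs_re_stdAddChar_le_one (m : ZMod L) : |(ZMod.stdAddChar m : ℂ).re| ≤ 1 := by
  have h := Complex.abs_re_le_norm (ZMod.stdAddChar m : ℂ)
  rwa [ZMod.stdAddChar_apply, Circle.norm_coe] at h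

/-- **Summation by parts on the cycle.** For `ψ = ZMod.stdAddChar` and a real `g`,
`(ψ(m) + ψ(−m) − 2) · Σ_n ψ(−mn) g(n) = Σ_n ψ(−mn) Δ²g(n)`. [folklore] -/
theorem stdAddChar_symm_sub_two_mul_sum (g : ZMod L → ℝ) (m : ZMod L) :
    ((ZMod.stdAddChar m : ℂ) + ZMod.stdAddChar (-m) - 2) *
        ∑ n : ZMod L, (ZMod.stdAddChar (-(m * n)) : ℂ) * g n =
      ∑ n : ZMod L, (ZMod.stdAddChar (-(m * n)) : ℂ) * (cycleLaplacian g n : ℝ) := by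
  have h1 : (ZMod.stdAddChar m : ℂ) * ∑ n : ZMod L, (ZMod.stdAddChar (-(m * n)) : ℂ) * g n =
      ∑ n : ZMod L, (ZMod.stdAddChar (-(m * n)) : ℂ) * g (n + 1) := by
    rw [mul_sum, ← Equiv.sum_comp (Equiv.addRight (1 : ZMod L))
      (fun n => (ZMod.stdAddChar m : ℂ) * ((ZMod.stdAddChar (-(m * n)) : ℂ) * g n))]
    refine sum_congr rfl fun n _ => ?_
    simp only [Equiv.coe_addRight]
    rw [← mul_assoc, ← AddChar.map_add_eq_mul]
    congr 2; ring
  have h2 : (ZMod.stdAddChar (-m) : ℂ) * ∑ n : ZMod L, (ZMod.stdAddChar (-(m * n)) : ℂ) * g n =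
      ∑ n : ZMod L, (ZMod.stdAddChar (-(m * n)) : ℂ) * g (n - 1) := by
    rw [mul_sum, ← Equiv.sum_comp (Equiv.subRight (1 : ZMod L))
      (fun n => (ZMod.stdAddChar (-m) : ℂ) * ((ZMod.stdAddChar (-(m * n)) : ℂ) * g n))]
    refine sum_congr rfl fun n _ => ?_
    simp only [Equiv.subRight_apply]
    rw [← mul_assoc, ← AddChar.map_add_eq_mul]
    congr 2; ring
  rw [sub_mul, add_mul, h1, h2, mul_sum, ← sum_add_distrib, ← sum_sub_distrib]
  refine sum_congr rfl fun n _ => ?_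
  simp only [cycleLaplacian]
  push_cast
  ring

/-- **Infrared-type bound from convexity off the origin.** If `Δ²g(n) ≥ 0` for all `n ≠ 0` on the
cycle `ℤ/Lℤ`, then for every `m`,
`(1 − Re ψ(m)) · Re Σ_n ψ(−mn) g(n) ≤ 2g(0) − g(1) − g(−1)` (`ψ = ZMod.stdAddChar`,
`Re ψ(m) = cos(2πm/L)`). This is the elementary core of the transfer-matrix proof of infrared
bounds: the right-hand side is `−Δ²g(0)`, in the applications a double-commutator expectation.
[folklore] -/
theorem one_sub_re_stdAddChar_mul_re_sum_le (g : ZMod L → ℝ)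
    (hconv : ∀ n : ZMod L, n ≠ 0 → 0 ≤ cycleLaplacian g n) (m : ZMod L) :
    (1 - (ZMod.stdAddChar m : ℂ).re) *
        (∑ n : ZMod L, (ZMod.stdAddChar (-(m * n)) : ℂ) * g n).re ≤
      2 * g 0 - g 1 - g (-1) := by
  classical
  have hsbp := stdAddChar_symm_sub_two_mul_sum g m
  -- the prefactor is the real number `2 Re ψ(m) − 2`
  have hpre : ((ZMod.stdAddChar m : ℂ) + ZMod.stdAddChar (-m) - 2) =
      ((2 * (ZMod.stdAddChar m : ℂ).re - 2 : ℝ) : ℂ) := by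
    rw [stdAddChar_neg_eq_conj, Complex.add_conj]
    push_cast; ring
  rw [hpre] at hsbp
  have hre := congrArg Complex.re hsbp
  rw [Complex.re_ofReal_mul] at hre
  -- real part of the right-hand side
  have hrhs : (∑ n : ZMod L, (ZMod.stdAddChar (-(m * n)) : ℂ) * (cycleLaplacian g n : ℝ)).re =
      ∑ n : ZMod L, (ZMod.stdAddChar (-(m * n)) : ℂ).re * cycleLaplacian g n := by
    rw [Complex.re_sum]
    refine sum_congr rfl fun n _ => ?_
    simp only [Complex.mul_re, Complex.ofReal_re, Complex.ofReal_im, mul_zero, sub_zero]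
  rw [hrhs] at hre
  -- `hre : (2 Re ψ m − 2) * S.re = Σ_n Re ψ(−mn) * Δ²g(n)`
  have hsplit : ∑ n : ZMod L, (ZMod.stdAddChar (-(m * n)) : ℂ).re * cycleLaplacian g n =
      cycleLaplacian g 0 +
        ∑ n ∈ univ.erase (0 : ZMod L), (ZMod.stdAddChar (-(m * n)) : ℂ).re * cycleLaplacian g n := by
    rw [← add_sum_erase _ _ (mem_univ (0 : ZMod L))]
    simp
  have hsum0 : ∑ n ∈ univ.erase (0 : ZMod L), cycleLaplacian g n = -cycleLaplacian g 0 := by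
    have h := sum_cycleLaplacian g
    rw [← add_sum_erase _ _ (mem_univ (0 : ZMod L))] at h
    linarith
  have hbound : -∑ n ∈ univ.erase (0 : ZMod L), (ZMod.stdAddChar (-(m * n)) : ℂ).re * cycleLaplacian g n
      ≤ ∑ n ∈ univ.erase (0 : ZMod L), cycleLaplacian g n := by
    rw [← sum_neg_distrib]
    refine sum_le_sum fun n hn => ?_
    have hn0 : n ≠ 0 := ne_of_mem_erase hn
    have hc := hconv n hn0
    have ha := abs_re_stdAddChar_le_one (-(m * n))
    have hlow : -1 ≤ (ZMod.stdAddChar (-(m * n)) : ℂ).re := by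
      have := neg_abs_le (ZMod.stdAddChar (-(m * n)) : ℂ).re; linarith
    nlinarith
  -- combine
  have hkey : 2 * ((1 - (ZMod.stdAddChar m : ℂ).re) *
      (∑ n : ZMod L, (ZMod.stdAddChar (-(m * n)) : ℂ) * g n).re) ≤ 2 * (-cycleLaplacian g 0) := by
    have : 2 * ((1 - (ZMod.stdAddChar m : ℂ).re) *
        (∑ n : ZMod L, (ZMod.stdAddChar (-(m * n)) : ℂ) * g n).re) =
        -((2 * (ZMod.stdAddChar m : ℂ).re - 2) *
          (∑ n : ZMod L, (ZMod.stdAddChar (-(m * n)) : ℂ) * g n).re) := by ring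
    rw [this, hre, hsplit]
    linarith
  have := neg_cycleLaplacian_zero g
  linarith

/-- The same bound written with the cosine: if `Δ²g(n) ≥ 0` for `n ≠ 0`, then
`(1 − cos(2πm/L)) · Re Σ_n ψ(−mn) g(n) ≤ 2g(0) − g(1) − g(−1)`. [folklore] -/
theorem one_sub_cos_mul_re_sum_le (g : ZMod L → ℝ)
    (hconv : ∀ n : ZMod L, n ≠ 0 → 0 ≤ cycleLaplacian g n) (m : ZMod L) :
    (1 - Real.cos (2 * Real.pi * m.val / L)) *
        (∑ n : ZMod L, (ZMod.stdAddChar (-(m * n)) : ℂ) * g n).re ≤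
      2 * g 0 - g 1 - g (-1) := by
  rw [← re_stdAddChar_eq_cos]
  exact one_sub_re_stdAddChar_mul_re_sum_le g hconv m

end Literature.Probability.LatticeModels

end
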